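import Literature.LinearAlgebra.Alternating.ExteriorAlgebraSpinorRepresentation
import Literature.Geometry.Kaehler.ComplexTorusLefschetzSl2Triple
import Literature.Geometry.Kaehler.ComplexTorusIntersectionNumbers
import HarnessLib

/-!
# The total Lie algebra of a complex torus is `𝔰𝔬(H₁(X; ℝ) ⊕ H¹(X; ℝ))`
# (Looijenga–Lunts 1997, §3 Proposition (3.3))

Topic `Literature/Geometry/Kaehler`, namespace `Literature.Geometry.Kaehler.ComplexTorus`; lane `lit-hodgefound`
(Track 2 foundations library), Layer A1 «complex tori · H^k = ⋀^k H¹», skeleton seat `lit-hodgefound-skel-1`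
(generation 16), row **A1-43** of `run/shared/lean/pub/lit-hodgefound/SKELETON.md`, FILE 2 of 2. FILE 1,
`LinearAlgebra/Alternating/ExteriorAlgebraSpinorRepresentation.lean`, constructs for any finite-dimensional
real `V` the spinor representation `spinorRep V : 𝔰𝔬(V ⊕ V^*) →ₗ⁅ℝ⁆ End_ℂ(⋀^• V^* ⊗ ℂ)` (Looijenga–Lunts (3.1)–(3.2))
with image Looijenga–Lunts' `𝔤 = spinorAlgebra V = lieSpan_ℝ {e_α e_β, i_a i_b}`; this file identifies, for the
complex torus `X = E/Λ` (`V = H₁(X; ℝ) = E`, `H^•(X, ℂ) = ⊕ₖ Alt^k_ℝ(E; ℂ) = GForm E ℂ`, row A1-07), the TOTAL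
LIE ALGEBRA `𝔤_tot(X; ℝ)` with that image.

## Source, verbatim (E. Looijenga, V. A. Lunts, *A Lie algebra attached to a projective variety*, Invent. Math.
129 (1997) 361–412 = arXiv:alg-geom/9604014; held corpus text `paper:arxiv-alg-geom_9604014` p0004 (§1),
p0006 ((1.9)), p0013 (§3); arXiv PDF pp. 4, 6, 18–19)

* §1 (1.1): "We say that a linear transformation `e : M → M` of degree `2` has the Lefschetz property if for
  all integers `k ≥ 0`, `e^k` maps `M_{-k}` isomorphically onto `M_k`. According to the Jacobson–Morozov lemma
  this is equivalent to the existence of [a] `K`-linear transformation `f` in `M` of degree `-2` such that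
  `[e, f] = h`. This `f` is then unique and `(e, h, f)` is a `𝔰𝔩(2)`-triple […] We let `𝔤(𝔞, M)` denote the Lie
  subalgebra of `𝔤𝔩(M)` generated by the transformations `e_a, f_a`."
* (1.9): "The corresponding semisimple Lie subalgebra of `aut H(X)` will be called the total Lie algebra of `M`
  and be denoted `𝔤_tot(X)` […] Clearly, `𝔤_tot(X)` is independent of the complex structure. For example, if `X`
  is a product of an even number of circles, then `𝔤_tot(X)` is defined."
* §3, before (3.3): "Now let `X` be a real torus of even dimension `2n`. We identify the universal cover of `X`
  with `H₁(X; ℝ)`. We will write `V` for this real vector space (of dimension `2n`) so that `H(X; ℝ) = ⋀^• V^*`.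
  […] Let `κ ∈ ⋀² V^*` be nondegenerate. If `α_{±1}, …, α_{±n}` is a basis of `V^*` such that
  `κ = ∑_{k=1}^n α_k ∧ α_{-k}` then `e_κ = ∑_{k=1}^n e_{α_k} e_{α_{-k}}`. If `a_{±1}, …, a_{±n}` is the dual basis,
  then we see from eq. (**) that `[e_κ, ∑ i_{a_{-k}} i_{a_k}] = -n + ∑ (e_{α_k} i_{a_k} + e_{α_{-k}} i_{a_{-k}})`.
  Since this element acts on `⋀^l V^*` as multiplication by `-n + l`, it follows that `f_κ` is defined and equal
  to `∑_{k=1}^n i_{a_{-k}} i_{a_k}`. The nondegenerate `2`-forms make up a nonempty open subset of `⋀² V^*` and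
  therefore span that space. The corresponding `2`-vectors form an open subset of `⋀² V` and so `𝔤_tot(X)` is
  generated by `𝔤₂ ⊕ 𝔤₋₂` as a Lie algebra. Combining this with the above computation gives:"
* **(3.3) Proposition.** "There is a natural identification `(𝔤_tot(X; ℝ), h) ≅ (𝔰𝔬(V^* ⊕ V), u)`; this is a
  real form of the case `(D_{2n}, A_{2n-1})`. Furthermore, `H^{ev}(X)[n]` is a semispinorial representation of
  `𝔤_tot(X; ℝ)` and a fundamental Jordan–Lefschetz module of `H²(X, ℝ)`."

## What is formalised (definitions with bodies; theorems; NO named fact, no `sorry`)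

* §1 `IsSymplecticBasis.lefschetzG_eq_sum_extR_mul` ("`e_κ = ∑ e_{α_k} e_{α_{-k}}`": the tree's `lefschetzG η` of
  `ComplexTorusLefschetzSl2Triple.lean` equals `∑ᵢ e_{eᵢ^*} e_{fᵢ^*}` in a symplectic frame, through skel-4's
  `IsSymplecticBasis.lefschetzPow_one_eq_sum`), `IsSymplecticBasis.lefschetzDualG_eq_sum_intC_mul`
  ("`f_κ = ∑ i_{a_{-k}} i_{a_k}`": `lefschetzDualG η = ∑ᵢ i_{fᵢ} i_{eᵢ}`, through `IsSymplecticBasis.lefschetzDual_eq`),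
  hence `lefschetzG_mem_spinorAlgebra`, `lefschetzDualG_mem_spinorAlgebra`; and **`u ↦ h`**:
  `spinorRepLin_gradingElement_eq_countingG` (`ρ(u) = deg - ½·2g = countingG E`, Huybrechts' `H`).
* §2 the Lefschetz property made explicit: `sl2_f_unique` ("This `f` is then unique", in any finite-dimensional
  Lie algebra over a field of characteristic `0`, via Mathlib's `IsSl2Triple.HasPrimitiveVectorWith.exists_nat` on
  the adjoint module), `nondegenerate_of_isSl2Triple` (an `sl₂`-partner of `L_η` forces `η` non-degenerate:
  `η^{∧g} = 0` for degenerate `η`, row A4-30's `wedgePow_ofRealForm_eq_zero_of_degenerate`, against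
  `L_η^g 1 ≠ 0` from the `sl₂`-string of the lowest-weight vector `1 ∈ H⁰`, the tree's
  `Algebra.Lie.Sl2.F_pow_apply_ne_zero`), `eq_lefschetzDualG_of_isSl2Triple`, and the equivalence
  **`isSl2Triple_iff`**: `(L_η, h, Λ)` is an `sl₂`-triple iff `η` is non-degenerate and `Λ = Λ_η`.
* §3 **`totalLieAlgebra E`** `:= lieSpan_ℝ {L_η, Λ | IsSl2Triple h L_η Λ}` (the shape of the tree's
  `Hyperkaehler.llvAlgebra`, on the forms carrier, over `ℝ` = Looijenga–Lunts' real form `𝔤_tot(X; ℝ)`), with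
  `lefschetzG_mem_totalLieAlgebra`, `mem_totalLieAlgebra_of_isSl2Triple`, `countingG_mem_totalLieAlgebra`,
  `totalLieAlgebra_le_spinorAlgebra`.
* §4 the standard form `frameForm b = ∑ᵢ eᵢ^* ∧ fᵢ^*` of a split real frame (`isSymplecticBasis_frameForm`,
  `frameForm_nondegenerate`), §5 "the nondegenerate `2`-forms … span": `e_α e_β`, `i_a i_b ∈ 𝔤_tot` from the pair
  of standard forms of the frames `b` and `b[f₀ ↦ 2f₀]` (`extR_mul_extR_mem_totalLieAlgebra`,
  `intC_mul_intC_mem_totalLieAlgebra`), `spinorAlgebra_le_totalLieAlgebra`.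
* §6 **(3.3)**: `totalLieAlgebra_eq_spinorAlgebra` (`g ≥ 1`), **`totalLieAlgebra_eq_range`**
  (`𝔤_tot(X; ℝ) = ρ(𝔰𝔬(V ⊕ V^*))`, `g ≥ 2`), the Lie algebra isomorphism **`totalLieAlgebraEquiv`**
  `: so E ≃ₗ⁅ℝ⁆ totalLieAlgebra E` with `totalLieAlgebraEquiv_gradingElement` (`u ↦ h`).
* §7 "semispinorial": `H^{ev}` and `H^{odd}` (`evenForms`, `oddForms`) are `𝔤_tot`-stable
  (`totalLieAlgebra_le_stabilizer_evenForms`, `totalLieAlgebra_le_stabilizer_oddForms`).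

SCOPE NOTES (faithfulness). (i) `V ⊕ V^*` versus `V^* ⊕ V` in (3.3) is the same split quadratic space
`q(x, ξ) = ξ(x)`; here `V = E = H₁(X; ℝ)` as in §3 of the source. (ii) The identification with `𝔰𝔬` needs
`g = dim_ℂ E ≥ 2` (FILE 1: (3.2) needs `dim_ℝ V ≥ 3`); for an elliptic curve `𝔤_tot = 𝔤 = 𝔰𝔩₂ ⊊ 𝔰𝔬(2, 2)`, and
`totalLieAlgebra_eq_spinorAlgebra` is still proved for `g = 1`. (iii) Of "semispinorial" only the
`𝔤_tot`-stability of `H^{ev}`, `H^{odd}` is formalised (not their irreducibility); the "fundamental Jordan–Lefschetz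
module" clause (§2 of the source) is not formalised. (iv) The rational structure ("defined over `ℚ`") is not
addressed here.

## References

* [LooijengaLunts1997] E. Looijenga, V. A. Lunts, *A Lie algebra attached to a projective variety*, Invent. Math.
  129 (1997), 361–412, §1 (1.1), (1.9), §3 (3.3).
* [McDuffSalamon2017] D. McDuff, D. Salamon, *Introduction to Symplectic Topology*, 3rd ed., OUP (2017), §2.1
  Thm. 2.1.3 (symplectic bases, the standard form).
* [Lang2002] S. Lang, *Algebra*, 3rd ed., GTM 211 (2002), III §6 (dual basis).
* [Warner1983] F. W. Warner, *Foundations of Differentiable Manifolds and Lie Groups*, GTM 94 (1983), 2.10–2.11.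
-/

noncomputable section

open Module Function LieModule
open Literature.LinearAlgebra.Alternating
open Literature.LinearAlgebra.Alternating.GForm (extR intC extRₗ intCₗ of_apply_self of_apply_of_ne
  of_eq_zero_iff of_zero extR_apply_succ extR_apply_zero intC_apply extRₗ_apply intCₗ_apply)

-- The commutator Lie ring of `Module.End ℂ (GForm E ℂ)`: Mathlib's reducible NON-instance
-- `LieRing.ofAssociativeRing`, enabled file-locally exactly as in `ComplexTorusLefschetzSl2Triple.lean`.
attribute [local instance 100] LieRing.ofAssociativeRing

namespace Literature.Geometry.Kaehler

namespace ComplexTorus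

/-! ### §1 `e_κ = ∑ₖ e_{α_k} e_{α_{-k}}` and `f_κ = ∑ₖ i_{a_{-k}} i_{a_k}` in a symplectic frame -/

section CAR

variable {E : Type*} [NormedAddCommGroup E] [NormedSpace ℂ E] [FiniteDimensional ℂ E] {n : ℕ}
  {b : Module.Basis (Fin n ⊕ Fin n) ℝ E} {η : E [⋀^Fin 2]→L[ℝ] ℝ}

/-- **`e_κ = ∑ₖ e_{α_k} e_{α_{-k}}`** ("If `α_{±1}, …, α_{±n}` is a basis of `V^*` such that
`κ = ∑ α_k ∧ α_{-k}` then `e_κ = ∑ e_{α_k} e_{α_{-k}}`"): in a symplectic frame `(eᵢ, fᵢ)` of `η` the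
Lefschetz operator `L = η ∧ ·` on `⊕ₖ ⋀ᵏ V^* ⊗ ℂ` is `∑ᵢ e_{eᵢ^*} e_{fᵢ^*}`.
[cite: LooijengaLunts1997, §3 proof of (3.3)] -/
theorem IsSymplecticBasis.lefschetzG_eq_sum_extR_mul (hb : IsSymplecticBasis η b) :
    lefschetzG η = ∑ i : Fin n, extR ((b.coord (Sum.inl i)).toContinuousLinearMap) *
      extR ((b.coord (Sum.inr i)).toContinuousLinearMap) := by
  refine LinearMap.ext fun w ↦ funext fun m ↦ ?_
  rw [LinearMap.sum_apply, Finset.sum_apply]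
  match m with
  | 0 => simp only [lefschetzG_apply_zero, Module.End.mul_apply, extR_apply_zero, Finset.sum_const_zero]
  | 1 =>
    simp only [lefschetzG_apply_one, Module.End.mul_apply, extR_apply_succ, extR_apply_zero, wedgeOne_zero,
      Finset.sum_const_zero]
  | m + 2 =>
    rw [lefschetzG_apply_add_two, hb.lefschetzPow_one_eq_sum]
    exact Finset.sum_congr rfl fun i _ ↦ by rw [Module.End.mul_apply, extR_apply_succ, extR_apply_succ]

/-- **`f_κ = ∑ₖ i_{a_{-k}} i_{a_k}`** ("it follows that `f_κ` is defined and equal to `∑ i_{a_{-k}} i_{a_k}`"):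
in a symplectic frame the dual Lefschetz operator `Λ` on `⊕ₖ ⋀ᵏ V^* ⊗ ℂ` is the OPERATOR `∑ᵢ i_{fᵢ} i_{eᵢ}` (skel-4's
`IsSymplecticBasis.lefschetzDual_eq`, reassembled on the total space; the pointwise `curryLeftG` form is
`IsSymplecticBasis.lefschetzDualG_eq_sum` of `ComplexTorusDivisorClassesPushforward.lean`, not imported here).
[cite: LooijengaLunts1997, §3 proof of (3.3)] -/
theorem IsSymplecticBasis.lefschetzDualG_eq_sum_intC_mul (hb : IsSymplecticBasis η b) :
    lefschetzDualG η = ∑ i : Fin n, intC (b (Sum.inr i)) * intC (b (Sum.inl i)) := by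
  refine LinearMap.ext fun w ↦ funext fun m ↦ ?_
  rw [LinearMap.sum_apply, Finset.sum_apply, lefschetzDualG_apply, hb.lefschetzDual_eq, contractFrame_apply]
  exact Finset.sum_congr rfl fun i _ ↦ by rw [Module.End.mul_apply, intC_apply, intC_apply]

/-- For a non-degenerate `η`, `L = e_η` lies in Looijenga–Lunts' `𝔤 = lieSpan {e_α e_β, i_a i_b}`.
[cite: LooijengaLunts1997, §3 proof of (3.3)] -/
theorem lefschetzG_mem_spinorAlgebra (hη : ∀ v : E, v ≠ 0 → ∃ w : E, η ![v, w] ≠ 0) :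
    lefschetzG η ∈ spinorAlgebra E := by
  obtain ⟨b, hb⟩ := exists_isSymplecticBasis hη
  rw [hb.lefschetzG_eq_sum_extR_mul]
  exact sum_mem fun i _ ↦ extR_mul_extR_mem E _ _

/-- For a non-degenerate `η`, `Λ = f_η` lies in Looijenga–Lunts' `𝔤`. [cite: LooijengaLunts1997, §3 proof of (3.3)] -/
theorem lefschetzDualG_mem_spinorAlgebra (hη : ∀ v : E, v ≠ 0 → ∃ w : E, η ![v, w] ≠ 0) :
    lefschetzDualG η ∈ spinorAlgebra E := by
  obtain ⟨b, hb⟩ := exists_isSymplecticBasis hη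
  rw [hb.lefschetzDualG_eq_sum_intC_mul]
  exact sum_mem fun i _ ↦ intC_mul_intC_mem E _ _

/-- **`u ↦ h`**: the spinor representation sends Looijenga–Lunts' grading element `u = (-1_V, 1_{V^*})` to
Huybrechts' counting operator `h = H = (deg - g)·Id` of the torus (`ρ(u) = deg - ½ dim_ℝ V` and
`dim_ℝ V = 2g`). [cite: LooijengaLunts1997, §3 (3.3)] -/
theorem spinorRepLin_gradingElement_eq_countingG :
    spinorRepLin E (gradingElement E) = countingG E := by
  rw [spinorRepLin_gradingElement]
  refine LinearMap.ext fun w ↦ funext fun m ↦ ?_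
  have h2 : ((finrank ℝ E : ℝ) / 2) = (finrank ℂ E : ℝ) := by
    rw [finrank_real_of_complex]; push_cast; ring
  rw [h2, LinearMap.sub_apply, LinearMap.smul_apply, Module.End.one_apply, Pi.sub_apply, Pi.smul_apply,
    degOp_apply, countingG_apply, sub_smul, RCLike.real_smul_eq_coe_smul (K := ℂ)]
  simp

end CAR

/-! ### §2 `sl₂`-partners of `L_η`: `Λ` exists iff `η` is non-degenerate, and then `Λ = Λ_η` -/

section Sl2

/-- **Uniqueness of the third member of an `sl₂`-triple** ("This `f` is then unique", Looijenga–Lunts (1.1)):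
in a finite-dimensional Lie algebra over a field of characteristic zero, `(h, e, f)` and `(h, e, f')` both
`sl₂`-triples force `f = f'` — `f - f'` would be a primitive vector of weight `-2` for the adjoint action.
[cite: LooijengaLunts1997, §1 (1.1)] -/
theorem sl2_f_unique {R L : Type*} [Field R] [CharZero R] [LieRing L] [LieAlgebra R L]
    [Module.Finite R L] {h e f f' : L} (t : IsSl2Triple h e f) (t' : IsSl2Triple h e f') : f = f' := by
  by_contra hne
  have P : t.HasPrimitiveVectorWith (M := L) (f - f') (-2 : R) :=
    { ne_zero := sub_ne_zero.2 hne
      lie_h := by rw [lie_sub, t.lie_lie_smul_f R, t'.lie_lie_smul_f R, smul_sub, neg_smul, neg_smul]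
      lie_e := by rw [lie_sub, t.lie_e_f, t'.lie_e_f, sub_self] }
  obtain ⟨n, hn⟩ := P.exists_nat
  have h' : ((n + 2 : ℕ) : R) = 0 := by push_cast; rw [← hn]; ring
  exact absurd (Nat.cast_eq_zero.1 h') (by omega)

variable {E : Type*} [NormedAddCommGroup E] [NormedSpace ℂ E] [FiniteDimensional ℂ E]
  {η : E [⋀^Fin 2]→L[ℝ] ℝ} {Λ : Module.End ℂ (GForm E ℂ)}

omit [FiniteDimensional ℂ E] in
/-- A partner `Λ` of `L_η` in an `sl₂`-triple `(L_η, h, Λ)` kills `H⁰` (it lowers the `h`-weight by `2`, and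
`-g - 2` is not a weight). [cite: LooijengaLunts1997, §1 (1.1)] -/
theorem apply_of_zero_eq_zero_of_isSl2Triple (t : IsSl2Triple (countingG E) (lefschetzG η) Λ)
    (c : E [⋀^Fin 0]→L[ℝ] ℂ) : Λ (GForm.of 0 c) = 0 := by
  have h0 : GForm.of 0 c ∈ (countingG E).eigenspace (((0 : ℕ) : ℂ) - (finrank ℂ E : ℂ)) :=
    Module.End.mem_eigenspace_iff.2 (countingG_of 0 c)
  have hΛ := Literature.Algebra.Lie.Sl2.apply_F_mem t h0
  funext m
  rw [Pi.zero_apply]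
  refine mem_eigenspace_countingG_iff.1 hΛ m fun h ↦ ?_
  have h' : ((m + 2 : ℕ) : ℂ) = 0 := by push_cast at h ⊢; linear_combination h
  exact absurd (Nat.cast_eq_zero.1 h') (by omega)

/-- The constant `1 ∈ H⁰ = ⋀⁰` as a graded form. [folklore] -/
private def unitForm (E : Type*) [NormedAddCommGroup E] [NormedSpace ℂ E] : GForm E ℂ :=
  GForm.of 0 (ContinuousAlternatingMap.constOfIsEmpty ℝ E (Fin 0) (1 : ℂ))

omit [FiniteDimensional ℂ E] in
/-- `1 ≠ 0` in `H⁰`. [folklore] -/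
private theorem unitForm_ne_zero : unitForm E ≠ 0 := by
  intro h
  have h1 := congrArg (fun w : GForm E ℂ ↦ w 0 ![]) h
  simp only [unitForm, of_apply_self, ContinuousAlternatingMap.constOfIsEmpty_apply, Pi.zero_apply,
    ContinuousAlternatingMap.coe_zero, one_ne_zero] at h1

/-- **A `2`-form with an `sl₂`-partner is non-degenerate** (the Lefschetz property of `e_η`, Looijenga–Lunts
(1.1): "`e^k` maps `M_{-k}` isomorphically onto `M_k` … equivalent to the existence of `f`"): if
`(L_η, h, Λ)` is an `sl₂`-triple on `H•(X, ℂ)` then `η` is non-degenerate — otherwise `η^{∧g} = 0`, whereas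
`L_η^g 1 ≠ 0` for the lowest-weight vector `1 ∈ H⁰` of weight `-g`. [cite: LooijengaLunts1997, §1 (1.1)] -/
theorem nondegenerate_of_isSl2Triple (t : IsSl2Triple (countingG E) (lefschetzG η) Λ) :
    ∀ v : E, v ≠ 0 → ∃ w : E, η ![v, w] ≠ 0 := by
  by_contra! hdeg
  obtain ⟨u, hu0, hu⟩ := hdeg
  -- `η^{∧g} = 0`
  have hwp : wedgePow (ofRealForm η) (finrank ℂ E) = 0 :=
    wedgePow_ofRealForm_eq_zero_of_degenerate (Module.finBasis ℝ E).equivFun.symm.toContinuousLinearEquiv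
      (finCongr (finrank_real_of_complex E).symm) η hu0 hu
  -- `1 ∈ H⁰` is a lowest-weight vector of weight `-g` killed by `Λ`, so `L^g 1 ≠ 0`
  have hwt : unitForm E ∈ Literature.Algebra.Lie.Sl2.wsp (-countingG E) ((finrank ℂ E : ℕ) : ℂ) := by
    rw [Literature.Algebra.Lie.Sl2.mem_wsp_iff, LinearMap.neg_apply, unitForm, countingG_of]
    simp
  have key := Literature.Algebra.Lie.Sl2.F_pow_apply_ne_zero t.symm hwt unitForm_ne_zero
    (apply_of_zero_eq_zero_of_isSl2Triple t _) le_rfl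
  apply key
  rw [unitForm, lefschetzG_pow_of η (finrank ℂ E) rfl, lefschetzPow_apply, hwp,
    ContinuousAlternatingMap.zero_wedge, ContinuousAlternatingMap.domDomCongr_zero, of_zero]

/-- **The `sl₂`-partner of `L_η` is the dual Lefschetz operator `Λ_η`** (uniqueness of `f`, Looijenga–Lunts
(1.1), against the tree's `sl₂`-triple `(L, Λ, H)` of `ComplexTorusLefschetzSl2Triple.lean`).
[cite: LooijengaLunts1997, §1 (1.1)] -/
theorem eq_lefschetzDualG_of_isSl2Triple [Nontrivial E] (t : IsSl2Triple (countingG E) (lefschetzG η) Λ) :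
    Λ = lefschetzDualG η :=
  sl2_f_unique (R := ℂ) t (isSl2Triple (nondegenerate_of_isSl2Triple t))

/-- **The Lefschetz property on a complex torus** (Looijenga–Lunts (1.1) made explicit on `H•(X, ℂ) = ⊕ₖ ⋀ᵏ V^*`):
`(L_η, h, Λ)` is an `sl₂`-triple iff `η` is non-degenerate and `Λ = Λ_η`. [cite: LooijengaLunts1997, §1 (1.1)] -/
theorem isSl2Triple_iff [Nontrivial E] :
    IsSl2Triple (countingG E) (lefschetzG η) Λ ↔
      (∀ v : E, v ≠ 0 → ∃ w : E, η ![v, w] ≠ 0) ∧ Λ = lefschetzDualG η :=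
  ⟨fun t ↦ ⟨nondegenerate_of_isSl2Triple t, eq_lefschetzDualG_of_isSl2Triple t⟩,
    fun ⟨hη, hΛ⟩ ↦ hΛ ▸ isSl2Triple hη⟩

end Sl2

/-! ### §3 The total Lie algebra `𝔤_tot(X; ℝ)` of a complex torus -/

section Total

variable (E : Type*) [NormedAddCommGroup E] [NormedSpace ℂ E]

/-- **The total Lie algebra `𝔤_tot(X; ℝ)` of the complex torus `X = E/Λ`** (Looijenga–Lunts (1.1) and (1.9):
"We let `𝔤(𝔞, M)` denote the Lie subalgebra of `𝔤𝔩(M)` generated by the transformations `e_a, f_a`" over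
the `a` with the Lefschetz property, `𝔞 = H²(X)`, `M = H(X)[n]`: "the total Lie algebra … `𝔤_tot(X)`";
"Clearly, `𝔤_tot(X)` is independent of the complex structure"): the real Lie subalgebra of
`𝔤𝔩(H•(X, ℂ))`, `H•(X, ℂ) = ⊕ₖ Alt^k_ℝ(E; ℂ) = GForm E ℂ`, generated by the Lefschetz operators `L_η` of the
real classes `η ∈ H²(X, ℝ) = Alt²_ℝ(E; ℝ)` and their partners `Λ` over all `sl₂`-triples `(L_η, h, Λ)`,
`h = countingG E` (the same shape as the tree's `Hyperkaehler.llvAlgebra` on singular cohomology).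
[cite: LooijengaLunts1997, §1 (1.1) and (1.9)] -/
def totalLieAlgebra : LieSubalgebra ℝ (Module.End ℂ (GForm E ℂ)) :=
  LieSubalgebra.lieSpan ℝ (Module.End ℂ (GForm E ℂ))
    {T | ∃ (η : E [⋀^Fin 2]→L[ℝ] ℝ) (Λ : Module.End ℂ (GForm E ℂ)),
      IsSl2Triple (countingG E) (lefschetzG η) Λ ∧ (T = lefschetzG η ∨ T = Λ)}

variable {E} {η : E [⋀^Fin 2]→L[ℝ] ℝ} {Λ : Module.End ℂ (GForm E ℂ)}

/-- `e_η ∈ 𝔤_tot` for `η` with the Lefschetz property. [cite: LooijengaLunts1997, §1 (1.1)] -/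
theorem lefschetzG_mem_totalLieAlgebra (t : IsSl2Triple (countingG E) (lefschetzG η) Λ) :
    lefschetzG η ∈ totalLieAlgebra E :=
  LieSubalgebra.subset_lieSpan ⟨η, Λ, t, Or.inl rfl⟩

/-- `f_η ∈ 𝔤_tot` for `η` with the Lefschetz property. [cite: LooijengaLunts1997, §1 (1.1)] -/
theorem mem_totalLieAlgebra_of_isSl2Triple (t : IsSl2Triple (countingG E) (lefschetzG η) Λ) :
    Λ ∈ totalLieAlgebra E :=
  LieSubalgebra.subset_lieSpan ⟨η, Λ, t, Or.inr rfl⟩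

/-- `h = [e_η, f_η] ∈ 𝔤_tot`. [cite: LooijengaLunts1997, §1 (1.1)] -/
theorem countingG_mem_totalLieAlgebra (t : IsSl2Triple (countingG E) (lefschetzG η) Λ) :
    countingG E ∈ totalLieAlgebra E := by
  rw [← t.lie_e_f]
  exact LieSubalgebra.lie_mem _ (lefschetzG_mem_totalLieAlgebra t) (mem_totalLieAlgebra_of_isSl2Triple t)

variable [FiniteDimensional ℂ E]

/-- `L_η ∈ 𝔤_tot` for a non-degenerate `η`. [cite: LooijengaLunts1997, §3 proof of (3.3)] -/
theorem lefschetzG_mem_totalLieAlgebra_of_nondegenerate [Nontrivial E]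
    (hη : ∀ v : E, v ≠ 0 → ∃ w : E, η ![v, w] ≠ 0) : lefschetzG η ∈ totalLieAlgebra E :=
  lefschetzG_mem_totalLieAlgebra (isSl2Triple hη)

/-- `Λ_η ∈ 𝔤_tot` for a non-degenerate `η`. [cite: LooijengaLunts1997, §3 proof of (3.3)] -/
theorem lefschetzDualG_mem_totalLieAlgebra [Nontrivial E]
    (hη : ∀ v : E, v ≠ 0 → ∃ w : E, η ![v, w] ≠ 0) : lefschetzDualG η ∈ totalLieAlgebra E :=
  mem_totalLieAlgebra_of_isSl2Triple (isSl2Triple hη)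

/-- **`𝔤_tot ⊆ 𝔤`**: every generator `e_η`, `f_η` of `𝔤_tot` is one of Looijenga–Lunts' `e_κ = ∑ e_{α_k}e_{α_{-k}}`,
`f_κ = ∑ i_{a_{-k}} i_{a_k}`. [cite: LooijengaLunts1997, §3 proof of (3.3)] -/
theorem totalLieAlgebra_le_spinorAlgebra [Nontrivial E] : totalLieAlgebra E ≤ spinorAlgebra E := by
  rw [totalLieAlgebra, LieSubalgebra.lieSpan_le]
  rintro T ⟨η, Λ, t, rfl | rfl⟩
  · exact lefschetzG_mem_spinorAlgebra (nondegenerate_of_isSl2Triple t)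
  · rw [eq_lefschetzDualG_of_isSl2Triple t]
    exact lefschetzDualG_mem_spinorAlgebra (nondegenerate_of_isSl2Triple t)

end Total

/-! ### §4 Standard symplectic forms of split frames -/

section FrameForm

variable {E : Type*} [NormedAddCommGroup E] [NormedSpace ℂ E] [FiniteDimensional ℂ E] {n : ℕ}

/-- **The standard symplectic form `η_b = ∑ᵢ eᵢ^* ∧ fᵢ^*` of a split real frame `b = (e₁, …, eₙ, f₁, …, fₙ)`**
(Looijenga–Lunts: "`κ = ∑ₖ α_k ∧ α_{-k}`"; McDuff–Salamon's standard form `ω₀` in a symplectic basis), a real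
`2`-form on `E`. [cite: LooijengaLunts1997, §3 proof of (3.3)] [cite: McDuffSalamon2017, §2.1 Thm. 2.1.3] -/
def frameForm (b : Module.Basis (Fin n ⊕ Fin n) ℝ E) : E [⋀^Fin 2]→L[ℝ] ℝ :=
  ∑ i : Fin n, wedgeOne ((b.coord (Sum.inl i)).toContinuousLinearMap)
    (wedgeOne ((b.coord (Sum.inr i)).toContinuousLinearMap)
      (ContinuousAlternatingMap.constOfIsEmpty ℝ E (Fin 0) (1 : ℝ)))

/-- The coordinate covector of a real basis as a continuous linear form: `x^*(b_y) = δ_{xy}`.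
[cite: Lang2002, III §6] -/
theorem coord_toContinuousLinearMap_apply {ι : Type*} [DecidableEq ι] (b : Module.Basis ι ℝ E) (x y : ι) :
    (b.coord x).toContinuousLinearMap (b y) = if y = x then (1 : ℝ) else 0 := by
  rw [LinearMap.coe_toContinuousLinearMap', Module.Basis.coord_apply, Module.Basis.repr_self,
    Finsupp.single_apply]

/-- `η_b(v, w) = ∑ᵢ (eᵢ^*(v) fᵢ^*(w) - eᵢ^*(w) fᵢ^*(v))` (the tree's `wedgeOne_wedgeOne_constOfIsEmpty_apply`, summed).
[cite: McDuffSalamon2017, §2.1 Thm. 2.1.3] -/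
theorem frameForm_apply (b : Module.Basis (Fin n ⊕ Fin n) ℝ E) (v w : E) :
    frameForm b ![v, w] = ∑ i : Fin n,
      ((b.coord (Sum.inl i)).toContinuousLinearMap v * (b.coord (Sum.inr i)).toContinuousLinearMap w -
        (b.coord (Sum.inl i)).toContinuousLinearMap w * (b.coord (Sum.inr i)).toContinuousLinearMap v) := by
  rw [frameForm, ContinuousAlternatingMap.sum_apply]
  exact Finset.sum_congr rfl fun i _ ↦ by rw [wedgeOne_wedgeOne_constOfIsEmpty_apply, smul_eq_mul, mul_one]

/-- **A split frame is a symplectic frame of its standard form**: `η_b(eᵢ, eⱼ) = η_b(fᵢ, fⱼ) = 0`,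
`η_b(eᵢ, fⱼ) = δᵢⱼ`. [cite: McDuffSalamon2017, §2.1 Thm. 2.1.3] -/
theorem isSymplecticBasis_frameForm (b : Module.Basis (Fin n ⊕ Fin n) ℝ E) : IsSymplecticBasis (frameForm b) b where
  inl_inl i j := by
    simp [frameForm_apply, coord_toContinuousLinearMap_apply]
  inr_inr i j := by
    simp [frameForm_apply, coord_toContinuousLinearMap_apply]
  inl_inr i j := by
    rw [frameForm_apply, Finset.sum_eq_single j (fun k _ hkj ↦ by simp [coord_toContinuousLinearMap_apply, hkj.symm])
      (fun h ↦ absurd (Finset.mem_univ j) h)]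
    by_cases h : i = j <;> simp [coord_toContinuousLinearMap_apply, h]

/-- The standard form of a split frame is non-degenerate. [cite: McDuffSalamon2017, §2.1 Thm. 2.1.3] -/
theorem frameForm_nondegenerate (b : Module.Basis (Fin n ⊕ Fin n) ℝ E) :
    ∀ v : E, v ≠ 0 → ∃ w : E, frameForm b ![v, w] ≠ 0 :=
  (isSymplecticBasis_frameForm b).nondegenerate

omit [FiniteDimensional ℂ E] in
/-- Coordinates of a reindexed basis. [cite: Lang2002, III §6] -/
theorem coord_reindex {ι ι' : Type*} (b : Module.Basis ι ℝ E) (e : ι ≃ ι') (i' : ι') :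
    (b.reindex e).coord i' = b.coord (e.symm i') := by
  ext v
  simp only [Module.Basis.coord_apply, Module.Basis.repr_reindex_apply]

/-- A permutation moving a prescribed pair `p ≠ q` to a prescribed pair `x ≠ y`. [folklore] -/
private theorem exists_perm_apply_eq {ι : Type*} [DecidableEq ι] {p q x y : ι} (hpq : p ≠ q) (hxy : x ≠ y) :
    ∃ σ : Equiv.Perm ι, σ p = x ∧ σ q = y := by
  refine ⟨(Equiv.swap q (Equiv.swap p x y)).trans (Equiv.swap p x), ?_, ?_⟩
  · have h : p ≠ Equiv.swap p x y := fun h ↦ hxy <| by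
      have h' := congrArg (Equiv.swap p x) h
      rwa [Equiv.swap_apply_left, Equiv.swap_apply_self] at h'
    rw [Equiv.trans_apply, Equiv.swap_apply_of_ne_of_ne hpq h, Equiv.swap_apply_left]
  · rw [Equiv.trans_apply, Equiv.swap_apply_left, Equiv.swap_apply_self]

variable (E) in
/-- A complex vector space of dimension `g ≥ 1` has a real frame of the split shape `(e₀, …, eₙ, f₀, …, fₙ)`,
`n + 1 = g`. [folklore] -/
private theorem exists_splitBasis [Nontrivial E] :
    ∃ n : ℕ, Nonempty (Module.Basis (Fin (n + 1) ⊕ Fin (n + 1)) ℝ E) := by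
  obtain ⟨n, hn⟩ := Nat.exists_eq_succ_of_ne_zero (Module.finrank_pos (R := ℂ) (M := E)).ne'
  refine ⟨n, ⟨(Module.finBasis ℝ E).reindex ((finCongr ?_).trans finSumFinEquiv.symm)⟩⟩
  rw [finrank_real_of_complex, hn]
  omega

end FrameForm

/-! ### §5 `𝔤 ⊆ 𝔤_tot`: the generators `e_α e_β`, `i_a i_b` from pairs of standard forms -/

section Generators

variable {E : Type*} [NormedAddCommGroup E] [NormedSpace ℂ E] [FiniteDimensional ℂ E] [Nontrivial E] {n : ℕ}

/-- **`e_{e₀^*} e_{f₀^*} ∈ 𝔤_tot`**: with `η = η_b` and `η'` the standard form of the frame `b'` obtained by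
`f₀ ↦ 2 f₀` (so `f₀^* ↦ ½ f₀^*`), `e_η - e_{η'} = ½ e_{e₀^*} e_{f₀^*}` (Looijenga–Lunts: "The nondegenerate
`2`-forms … span that space"). [cite: LooijengaLunts1997, §3 proof of (3.3)] -/
theorem extR_mul_extR_mem_totalLieAlgebra_frame (b : Module.Basis (Fin (n + 1) ⊕ Fin (n + 1)) ℝ E) :
    extR ((b.coord (Sum.inl 0)).toContinuousLinearMap) * extR ((b.coord (Sum.inr 0)).toContinuousLinearMap) ∈
      totalLieAlgebra E := by
  classical
  let u : Fin (n + 1) ⊕ Fin (n + 1) → ℝˣ := Function.update 1 (Sum.inr 0) (Units.mk0 2 two_ne_zero)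
  let b₂ := b.unitsSMul u
  have hcl : ∀ i, b₂.coord (Sum.inl i) = b.coord (Sum.inl i) := fun i ↦ by
    rw [Module.Basis.coord_unitsSMul]
    simp [u]
  have hcr : ∀ i : Fin n, b₂.coord (Sum.inr i.succ) = b.coord (Sum.inr i.succ) := fun i ↦ by
    rw [Module.Basis.coord_unitsSMul]
    simp [u, Fin.succ_ne_zero]
  have hc0 : b₂.coord (Sum.inr 0) = (2 : ℝ)⁻¹ • b.coord (Sum.inr 0) := by
    rw [Module.Basis.coord_unitsSMul]
    simp [u, Units.smul_def]
  have L1 := lefschetzG_mem_totalLieAlgebra_of_nondegenerate (frameForm_nondegenerate b)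
  have L2 := lefschetzG_mem_totalLieAlgebra_of_nondegenerate (frameForm_nondegenerate b₂)
  rw [(isSymplecticBasis_frameForm b).lefschetzG_eq_sum_extR_mul, Fin.sum_univ_succ] at L1
  rw [(isSymplecticBasis_frameForm b₂).lefschetzG_eq_sum_extR_mul, Fin.sum_univ_succ] at L2
  simp only [hcl, hcr, hc0, map_smul, ← extRₗ_apply, mul_smul_comm] at L2
  simp only [extRₗ_apply] at L2
  set P := extR ((b.coord (Sum.inl 0)).toContinuousLinearMap) * extR ((b.coord (Sum.inr 0)).toContinuousLinearMap)
  set R := ∑ i : Fin n, extR ((b.coord (Sum.inl i.succ)).toContinuousLinearMap) *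
    extR ((b.coord (Sum.inr i.succ)).toContinuousLinearMap)
  have key : P = (2 : ℝ) • ((P + R) - ((2 : ℝ)⁻¹ • P + R)) := by module
  rw [key]
  exact (totalLieAlgebra E).smul_mem 2 (sub_mem L1 L2)

/-- **`i_{f₀} i_{e₀} ∈ 𝔤_tot`**: with the same pair of frames, `f_{η'} - f_η = i_{f₀} i_{e₀}`.
[cite: LooijengaLunts1997, §3 proof of (3.3)] -/
theorem intC_mul_intC_mem_totalLieAlgebra_frame (b : Module.Basis (Fin (n + 1) ⊕ Fin (n + 1)) ℝ E) :
    intC (b (Sum.inr 0)) * intC (b (Sum.inl 0)) ∈ totalLieAlgebra E := by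
  classical
  let u : Fin (n + 1) ⊕ Fin (n + 1) → ℝˣ := Function.update 1 (Sum.inr 0) (Units.mk0 2 two_ne_zero)
  let b₂ := b.unitsSMul u
  have hbl : ∀ i, b₂ (Sum.inl i) = b (Sum.inl i) := fun i ↦ by
    rw [Module.Basis.unitsSMul_apply]
    simp [u]
  have hbr : ∀ i : Fin n, b₂ (Sum.inr i.succ) = b (Sum.inr i.succ) := fun i ↦ by
    rw [Module.Basis.unitsSMul_apply]
    simp [u, Fin.succ_ne_zero]
  have hb0 : b₂ (Sum.inr 0) = (2 : ℝ) • b (Sum.inr 0) := by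
    rw [Module.Basis.unitsSMul_apply]
    simp [u, Units.smul_def]
  have L1 := lefschetzDualG_mem_totalLieAlgebra (frameForm_nondegenerate b)
  have L2 := lefschetzDualG_mem_totalLieAlgebra (frameForm_nondegenerate b₂)
  rw [(isSymplecticBasis_frameForm b).lefschetzDualG_eq_sum_intC_mul, Fin.sum_univ_succ] at L1
  rw [(isSymplecticBasis_frameForm b₂).lefschetzDualG_eq_sum_intC_mul, Fin.sum_univ_succ] at L2
  simp only [hbl, hbr, hb0, GForm.intC_smul, smul_mul_assoc] at L2
  set Q := intC (b (Sum.inr 0)) * intC (b (Sum.inl 0))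
  set R := ∑ i : Fin n, intC (b (Sum.inr i.succ)) * intC (b (Sum.inl i.succ))
  have key : Q = ((2 : ℝ) • Q + R) - (Q + R) := by module
  rw [key]
  exact sub_mem L2 L1

/-- `e_{x^*} e_{y^*} ∈ 𝔤_tot` for any two coordinate covectors of a split frame. [cite: LooijengaLunts1997, §3 proof of (3.3)] -/
theorem extR_coord_mul_extR_coord_mem_totalLieAlgebra (b : Module.Basis (Fin (n + 1) ⊕ Fin (n + 1)) ℝ E)
    (x y : Fin (n + 1) ⊕ Fin (n + 1)) :
    extR ((b.coord x).toContinuousLinearMap) * extR ((b.coord y).toContinuousLinearMap) ∈ totalLieAlgebra E := by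
  classical
  rcases eq_or_ne x y with rfl | hxy
  · rw [GForm.extR_mul_self]
    exact zero_mem _
  · obtain ⟨σ, hσx, hσy⟩ := exists_perm_apply_eq (p := Sum.inl 0) (q := Sum.inr 0) Sum.inl_ne_inr hxy
    have key := extR_mul_extR_mem_totalLieAlgebra_frame (b.reindex σ.symm)
    rwa [coord_reindex, coord_reindex, Equiv.symm_symm, hσx, hσy] at key

/-- `i_{b_x} i_{b_y} ∈ 𝔤_tot` for any two vectors of a split frame. [cite: LooijengaLunts1997, §3 proof of (3.3)] -/
theorem intC_basis_mul_intC_basis_mem_totalLieAlgebra (b : Module.Basis (Fin (n + 1) ⊕ Fin (n + 1)) ℝ E)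
    (x y : Fin (n + 1) ⊕ Fin (n + 1)) : intC (b x) * intC (b y) ∈ totalLieAlgebra E := by
  classical
  rcases eq_or_ne x y with rfl | hxy
  · rw [GForm.intC_mul_self]
    exact zero_mem _
  · obtain ⟨σ, hσx, hσy⟩ := exists_perm_apply_eq (p := Sum.inr 0) (q := Sum.inl 0) Sum.inr_ne_inl hxy
    have key := intC_mul_intC_mem_totalLieAlgebra_frame (b.reindex σ.symm)
    rwa [Module.Basis.reindex_apply, Module.Basis.reindex_apply, Equiv.symm_symm, hσx, hσy] at key

omit [Nontrivial E] in
/-- Expansion of a continuous real covector in the dual frame: `α = ∑ₓ α(b_x) x^*`. [cite: Lang2002, III §6] -/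
theorem clm_eq_sum_smul_coord {ι : Type*} [Fintype ι] (b : Module.Basis ι ℝ E) (α : E →L[ℝ] ℝ) :
    α = ∑ x, α (b x) • (b.coord x).toContinuousLinearMap := by
  ext v
  simp only [FunLike.coe_sum, Finset.sum_apply, FunLike.coe_smul, Pi.smul_apply,
    LinearMap.coe_toContinuousLinearMap', Module.Basis.coord_apply, smul_eq_mul]
  conv_lhs => rw [← b.sum_repr v]
  simp only [_root_.map_sum, map_smul, smul_eq_mul, mul_comm]

/-- **`e_α e_β ∈ 𝔤_tot(X; ℝ)`** for all real covectors `α, β` (bilinear expansion in a split frame).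
[cite: LooijengaLunts1997, §3 proof of (3.3)] -/
theorem extR_mul_extR_mem_totalLieAlgebra (α β : E →L[ℝ] ℝ) : extR α * extR β ∈ totalLieAlgebra E := by
  obtain ⟨n, ⟨b⟩⟩ := exists_splitBasis E
  rw [clm_eq_sum_smul_coord b α, clm_eq_sum_smul_coord b β, ← extRₗ_apply, ← extRₗ_apply, _root_.map_sum,
    _root_.map_sum, Finset.sum_mul]
  refine sum_mem fun x _ ↦ ?_
  rw [Finset.mul_sum]
  refine sum_mem fun y _ ↦ ?_
  rw [map_smul, map_smul, extRₗ_apply, extRₗ_apply, smul_mul_assoc, mul_smul_comm]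
  exact (totalLieAlgebra E).smul_mem _ ((totalLieAlgebra E).smul_mem _
    (extR_coord_mul_extR_coord_mem_totalLieAlgebra b x y))

/-- **`i_a i_c ∈ 𝔤_tot(X; ℝ)`** for all vectors `a, c`. [cite: LooijengaLunts1997, §3 proof of (3.3)] -/
theorem intC_mul_intC_mem_totalLieAlgebra (a c : E) : intC a * intC c ∈ totalLieAlgebra E := by
  obtain ⟨n, ⟨b⟩⟩ := exists_splitBasis E
  rw [← b.sum_repr a, ← b.sum_repr c, ← intCₗ_apply, ← intCₗ_apply, _root_.map_sum, _root_.map_sum,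
    Finset.sum_mul]
  refine sum_mem fun x _ ↦ ?_
  rw [Finset.mul_sum]
  refine sum_mem fun y _ ↦ ?_
  rw [map_smul, map_smul, intCₗ_apply, intCₗ_apply, smul_mul_assoc, mul_smul_comm]
  exact (totalLieAlgebra E).smul_mem _ ((totalLieAlgebra E).smul_mem _
    (intC_basis_mul_intC_basis_mem_totalLieAlgebra b x y))

/-- **`𝔤 ⊆ 𝔤_tot`.** [cite: LooijengaLunts1997, §3 proof of (3.3)] -/
theorem spinorAlgebra_le_totalLieAlgebra : spinorAlgebra E ≤ totalLieAlgebra E := by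
  rw [spinorAlgebra, LieSubalgebra.lieSpan_le]
  rintro T (⟨α, β, rfl⟩ | ⟨a, c, rfl⟩)
  exacts [extR_mul_extR_mem_totalLieAlgebra α β, intC_mul_intC_mem_totalLieAlgebra a c]

end Generators

/-! ### §6 Proposition (3.3): `(𝔤_tot(X; ℝ), h) ≅ (𝔰𝔬(V ⊕ V^*), u)` -/

section Main

variable (E : Type*) [NormedAddCommGroup E] [NormedSpace ℂ E] [FiniteDimensional ℂ E]

/-- **`𝔤_tot(X; ℝ) = 𝔤`** ("so `𝔤_tot(X)` is generated by `𝔤₂ ⊕ 𝔤₋₂` as a Lie algebra"): the total Lie algebra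
of a complex torus of dimension `g ≥ 1` is Looijenga–Lunts' `𝔤 = lieSpan {e_α e_β, i_a i_b}` (for `g = 1` both
are `𝔰𝔩₂`). [cite: LooijengaLunts1997, §3 proof of (3.3)] -/
theorem totalLieAlgebra_eq_spinorAlgebra [Nontrivial E] : totalLieAlgebra E = spinorAlgebra E :=
  le_antisymm totalLieAlgebra_le_spinorAlgebra spinorAlgebra_le_totalLieAlgebra

variable {E} in
omit [FiniteDimensional ℂ E] in
/-- `dim_ℂ E ≥ 2` gives `dim_ℝ E ≥ 3` (indeed `≥ 4`), the scope of (3.2). [folklore] -/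
private theorem three_le_finrank_real (h2 : 2 ≤ finrank ℂ E) : 3 ≤ finrank ℝ E := by
  rw [finrank_real_of_complex]; omega

variable {E} in
omit [FiniteDimensional ℂ E] in
/-- `dim_ℂ E ≥ 2` makes `E` non-trivial. [folklore] -/
private theorem nontrivial_of_two_le (h2 : 2 ≤ finrank ℂ E) : Nontrivial E :=
  Module.nontrivial_of_finrank_pos (R := ℂ) (by omega)

/-- **Looijenga–Lunts (3.3): `𝔤_tot(X; ℝ) = ρ(𝔰𝔬(V ⊕ V^*))`**, the image of the spinor representation of
`ExteriorAlgebraSpinorRepresentation.lean`, for a complex torus `X = E/Λ` of dimension `g ≥ 2`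
(`V = H₁(X; ℝ) = E`, `dim_ℝ V = 2g ≥ 4`). [cite: LooijengaLunts1997, §3 (3.3)] -/
theorem totalLieAlgebra_eq_range (h2 : 2 ≤ finrank ℂ E) : totalLieAlgebra E = (spinorRep E).range := by
  haveI := nontrivial_of_two_le h2
  rw [totalLieAlgebra_eq_spinorAlgebra, range_spinorRep_eq E (three_le_finrank_real h2)]

/-- **Looijenga–Lunts (3.3), the identification `𝔰𝔬(V ⊕ V^*) ≅ 𝔤_tot(X; ℝ)` of real Lie algebras** (`g ≥ 2`;
"a real form of the case `(D_{2n}, A_{2n-1})`"), through the spinor representation.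
[cite: LooijengaLunts1997, §3 (3.3)] -/
def totalLieAlgebraEquiv (h2 : 2 ≤ finrank ℂ E) : so E ≃ₗ⁅ℝ⁆ totalLieAlgebra E :=
  (spinorRepEquivRange E).trans (LieEquiv.ofEq _ _ (congrArg SetLike.coe (totalLieAlgebra_eq_range E h2).symm))

/-- The identification is `T ↦ ρ(T)`. [cite: LooijengaLunts1997, §3 (3.3)] -/
@[simp]
theorem totalLieAlgebraEquiv_apply (h2 : 2 ≤ finrank ℂ E) (T : so E) :
    (totalLieAlgebraEquiv E h2 T : Module.End ℂ (GForm E ℂ)) = spinorRepLin E T := rfl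

/-- **`u ↦ h`** under the identification: the grading element of `𝔰𝔬(V ⊕ V^*)` goes to the counting operator
`h` of `𝔤_tot(X; ℝ)` ("`(𝔤_tot(X; ℝ), h) ≅ (𝔰𝔬(V^* ⊕ V), u)`"). [cite: LooijengaLunts1997, §3 (3.3)] -/
theorem totalLieAlgebraEquiv_gradingElement (h2 : 2 ≤ finrank ℂ E) :
    (totalLieAlgebraEquiv E h2 ⟨gradingElement E, gradingElement_mem_so E⟩ : Module.End ℂ (GForm E ℂ)) =
      countingG E := by
  rw [totalLieAlgebraEquiv_apply, spinorRepLin_gradingElement_eq_countingG]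

/-- `h ∈ 𝔤_tot(X; ℝ)` (`g ≥ 1`). [cite: LooijengaLunts1997, §3 (3.3)] -/
theorem countingG_mem_totalLieAlgebra' [Nontrivial E] : countingG E ∈ totalLieAlgebra E := by
  obtain ⟨n, ⟨b⟩⟩ := exists_splitBasis E
  exact countingG_mem_totalLieAlgebra (isSl2Triple (frameForm_nondegenerate b))

end Main

/-! ### §7 "`H^{ev}(X)[n]` is a semispinorial representation": the parity decomposition is `𝔤_tot`-stable -/

section Parity

variable (E : Type*) [NormedAddCommGroup E] [NormedSpace ℂ E]

/-- **The even part `H^{ev}(X, ℂ) = ⊕ₖ H^{2k}`** of the graded forms. [cite: LooijengaLunts1997, §3 (3.3)] -/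
def evenForms : Submodule ℂ (GForm E ℂ) where
  carrier := {w | ∀ m, Odd m → w m = 0}
  add_mem' ha hb m hm := by rw [Pi.add_apply, ha m hm, hb m hm, add_zero]
  zero_mem' _ _ := rfl
  smul_mem' c w hw m hm := by rw [Pi.smul_apply, hw m hm, smul_zero]

/-- **The odd part `H^{odd}(X, ℂ) = ⊕ₖ H^{2k+1}`** of the graded forms. [cite: LooijengaLunts1997, §3 (3.3)] -/
def oddForms : Submodule ℂ (GForm E ℂ) where
  carrier := {w | ∀ m, Even m → w m = 0}
  add_mem' ha hb m hm := by rw [Pi.add_apply, ha m hm, hb m hm, add_zero]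
  zero_mem' _ _ := rfl
  smul_mem' c w hw m hm := by rw [Pi.smul_apply, hw m hm, smul_zero]

variable {E}

/-- Membership in `H^{ev}`. [cite: LooijengaLunts1997, §3 (3.3)] -/
theorem mem_evenForms_iff {w : GForm E ℂ} : w ∈ evenForms E ↔ ∀ m, Odd m → w m = 0 := Iff.rfl

/-- Membership in `H^{odd}`. [cite: LooijengaLunts1997, §3 (3.3)] -/
theorem mem_oddForms_iff {w : GForm E ℂ} : w ∈ oddForms E ↔ ∀ m, Even m → w m = 0 := Iff.rfl

/-- **The stabiliser of a subspace `W ⊆ H•(X, ℂ)`** in the real Lie algebra `𝔤𝔩(H•(X, ℂ))`. [folklore] -/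
def stabilizer (W : Submodule ℂ (GForm E ℂ)) : LieSubalgebra ℝ (Module.End ℂ (GForm E ℂ)) where
  carrier := {T | ∀ w ∈ W, T w ∈ W}
  add_mem' hS hT w hw := by rw [LinearMap.add_apply]; exact W.add_mem (hS w hw) (hT w hw)
  zero_mem' w _ := by rw [LinearMap.zero_apply]; exact W.zero_mem
  smul_mem' c T hT w hw := by
    rw [LinearMap.smul_apply, RCLike.real_smul_eq_coe_smul (K := ℂ)]
    exact W.smul_mem _ (hT w hw)
  lie_mem' {S T} hS hT w hw := by
    rw [LieRing.of_associative_ring_bracket, LinearMap.sub_apply, Module.End.mul_apply, Module.End.mul_apply]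
    exact W.sub_mem (hS _ (hT w hw)) (hT _ (hS w hw))

/-- A parity-respecting predicate on degrees: `P m ↔ P (m + 2)`. [folklore] -/
private theorem parity_shift {P : ℕ → Prop} (hP : P = Odd ∨ P = Even) (m : ℕ) : P (m + 2) ↔ P m := by
  rcases hP with rfl | rfl
  · exact Nat.odd_add.trans (by simp [Nat.odd_iff])
  · exact Nat.even_add.trans (by simp [Nat.even_iff])

/-- `e_α e_β` preserves every parity class of degrees. [cite: LooijengaLunts1997, §3 (3.3)] -/
private theorem extR_mul_extR_apply_parity {P : ℕ → Prop} (hP : P = Odd ∨ P = Even) (α β : E →L[ℝ] ℝ)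
    {w : GForm E ℂ} (hw : ∀ m, P m → w m = 0) : ∀ m, P m → (extR α * extR β) w m = 0
  | 0, _ => by rw [Module.End.mul_apply, extR_apply_zero]
  | 1, _ => by rw [Module.End.mul_apply, extR_apply_succ, extR_apply_zero, wedgeOne_zero]
  | m + 2, hm => by
    rw [Module.End.mul_apply, extR_apply_succ, extR_apply_succ, hw m ((parity_shift hP m).1 hm), wedgeOne_zero,
      wedgeOne_zero]

/-- `i_a i_c` preserves every parity class of degrees. [cite: LooijengaLunts1997, §3 (3.3)] -/
private theorem intC_mul_intC_apply_parity {P : ℕ → Prop} (hP : P = Odd ∨ P = Even) (a c : E)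
    {w : GForm E ℂ} (hw : ∀ m, P m → w m = 0) (m : ℕ) (hm : P m) : (intC a * intC c) w m = 0 := by
  rw [Module.End.mul_apply, intC_apply, intC_apply, hw (m + 1 + 1) ((parity_shift hP m).2 hm)]
  simp only [ContinuousAlternatingMap.curryLeft_zero, _root_.zero_apply]

/-- `𝔤` stabilises the forms vanishing on a parity class of degrees. [cite: LooijengaLunts1997, §3 (3.3)] -/
private theorem spinorAlgebra_le_stabilizer_parity [FiniteDimensional ℂ E] {P : ℕ → Prop} (hP : P = Odd ∨ P = Even)
    (W : Submodule ℂ (GForm E ℂ)) (hW : ∀ w, w ∈ W ↔ ∀ m, P m → w m = 0) :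
    spinorAlgebra E ≤ stabilizer W := by
  rw [spinorAlgebra, LieSubalgebra.lieSpan_le]
  rintro T (⟨α, β, rfl⟩ | ⟨a, c, rfl⟩) w hw
  · exact (hW _).2 (extR_mul_extR_apply_parity hP α β ((hW w).1 hw))
  · exact (hW _).2 (intC_mul_intC_apply_parity hP a c ((hW w).1 hw))

/-- **`H^{ev}(X, ℂ)` is a `𝔤_tot(X; ℝ)`-subrepresentation** (the carrier of Looijenga–Lunts' "semispinorial
representation `H^{ev}(X)[n]`"; irreducibility is not formalised here). [cite: LooijengaLunts1997, §3 (3.3)] -/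
theorem totalLieAlgebra_le_stabilizer_evenForms [FiniteDimensional ℂ E] [Nontrivial E] :
    totalLieAlgebra E ≤ stabilizer (evenForms E) := by
  rw [totalLieAlgebra_eq_spinorAlgebra]
  exact spinorAlgebra_le_stabilizer_parity (Or.inl rfl) _ fun _ ↦ Iff.rfl

/-- **`H^{odd}(X, ℂ)` is a `𝔤_tot(X; ℝ)`-subrepresentation** (the other half-spin summand).
[cite: LooijengaLunts1997, §3 (3.3)] -/
theorem totalLieAlgebra_le_stabilizer_oddForms [FiniteDimensional ℂ E] [Nontrivial E] :
    totalLieAlgebra E ≤ stabilizer (oddForms E) := by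
  rw [totalLieAlgebra_eq_spinorAlgebra]
  exact spinorAlgebra_le_stabilizer_parity (Or.inr rfl) _ fun _ ↦ Iff.rfl

end Parity

end ComplexTorus

end Literature.Geometry.Kaehler
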